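import Summits.ABC.IUTFork.Repair.CandMochizuki7RamInd
import Summits.ABC.IUTFork.Cor312PinnedRegions
import HarnessLib

/-!
# IUT REPAIR BRANCH (rung LADDER-ABC:A2.RP) — the frozen Θ-pin (pΘ) on the RAMIFIED SHEAR bed: UNSATISFIABLE for every region reading

Record file (D-0012; MODEL DATA `shear0`/`gfam`/`stabFam` — an (Ind2)-family STABILISING the Θ-pilot's Kummer tuple —, then proofs; no `Prop`
fact; nothing asserted about print; the adjudication-closure file `Cor312PinnedRegions` is IMPORTED, not edited — DEFS-FREEZE) of the abc-iut cell,
seat abc-iut-rp-m1 (gen 3; class (ii)). TAKES NO SIDE on [IUTchIII] Cor. 3.12 or on any author; typed ≠ proved. Sequel to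
`Repair/CandMochizuki7Ram` / `…RamInd` (RAM(p, m): rank-2 shells, Ism = ALL lattice automorphisms — the Dupuy–Hilado arXiv:2004.13228 v1 §4.9
reading, absent from the journal version —, honest column `ramColumn` with Θ-tuple `(π^{m·j²})_j`).

WHY RAM CARRIES NO «PINNED» CELLS. The frozen Θ-pin `Cor312Vol.ThetaPinned S P ρ` (abc-iut-w5-d230/PR-1, plan/ADJUDICATION-SPEC (G-PINNED-2))
has TWO clauses: (hρ) the region reading `ρ` is ⟨Ind1∪Ind2⟩-EQUIVARIANT on ALL data (`ρ(Φ·Ψ) = Φ(ρ Ψ)`), and (pΘ) `thetaRegion m = ρ(frobΨ m)`.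
Together they force: every indeterminacy that FIXES the Θ-pilot's Kummer datum fixes its REGION (`thetaRegion_stable_of_thetaPinned`). On
the beds of record (packets = lines, indeterminacies = scalars) the stabiliser of a nonzero datum is trivial on regions, so the clause is
idle. On RAM it is not: the (Ind2)-family `stabFam` = «shear `1 ↦ 1, π ↦ π + 1` on the FIRST tensor factor, identity elsewhere» FIXES the
Θ-tuple (whose entries `p^a·e_{1…1}`, `p^a·e_{1…1π}` have first factor `1`) but MOVES the Θ-box `box m` at label 1
(`stabFam_moves_thetaBox`). HENCE **`not_thetaPinned_ram`: for EVERY region reading `ρ` and every `m`, `¬ ThetaPinned (ramLattice p m) (ramSetting p m) ρ`**, so `¬ PinnedRegions`, and the pinned schemata (`GapA″`, `GapA3`, `GapH3`) hold VACUOUSLY on RAM — which is why this seat's RAM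
cells are filed at Statement / Licence / datum level only (`Cor312RamifiedSetting`, `CandMochizuki7Ram`). READING (neutral, about OUR typing,
not about print): the (hρ) clause of the frozen pin encodes «indeterminacies act on regions through their action on Kummer data», exact for
scalar/isometric (Ind2) and false for lattice shears at a ramified place; a pin for non-isometric (Ind2) would have to drop (hρ) or read
regions as ORBIT-saturated. Nothing here bears on [IUTchIII] Cor. 3.12. [claim: Mochizuki2012, status: disputed]
-/

noncomputable section

open Set

namespace Summit.ABC.IUTFork.Repair.CandMochizuki7Ram

open Thm311 Cor312 Cor312.Checks Cor312.IdentifiedNonVacuity Cor312Vol Cor312Vol.NaiveWitness Cor312Vol.PinnedWitness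
  Cor312Vol.RamifiedWitness Literature.IUT.LogThetaLattice

variable (p : ℕ) [hp : Fact p.Prime]

/-! ## 1. The shear `1 ↦ 1, π ↦ π + 1` of `ℚ² = ℚ·1 ⊕ ℚ·π` and the stabilising (Ind2)-family -/

/-- The nilpotent part `x ↦ x_π·e_1` of the shear. [folklore] -/
def shear0Nil : (Fin 2 → ℚ) →ₗ[ℚ] (Fin 2 → ℚ) :=
  (LinearMap.toSpanSingleton ℚ _ (Pi.single 0 1)) ∘ₗ LinearMap.proj 1

omit hp in
/-- `shear0Nil x = x_π·e_1`. [folklore] -/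
@[simp] theorem shear0Nil_apply (x : Fin 2 → ℚ) : shear0Nil x = x 1 • Pi.single (0 : Fin 2) (1 : ℚ) := rfl

omit hp in
/-- `shear0Nil ∘ shear0Nil = 0`. [folklore] -/
theorem shear0Nil_shear0Nil (x : Fin 2 → ℚ) : shear0Nil (shear0Nil x) = 0 := by
  rw [shear0Nil_apply, shear0Nil_apply]
  simp

/-- **The SHEAR `shear0`**: `(x_1, x_π) ↦ (x_1 + x_π, x_π)` — matrix `[[1,1],[0,1]]` in the basis `(1, π)`: a lattice automorphism of `I` fixing
the vector `1`. [claim: Mochizuki2012, status: disputed] -/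
def shear0 : (Fin 2 → ℚ) ≃ₗ[ℚ] (Fin 2 → ℚ) :=
  LinearEquiv.ofLinear (LinearMap.id + shear0Nil) (LinearMap.id - shear0Nil)
    (LinearMap.ext fun x => by
      simp only [LinearMap.comp_apply, LinearMap.add_apply, LinearMap.sub_apply, LinearMap.id_apply, map_sub, shear0Nil_shear0Nil]
      abel)
    (LinearMap.ext fun x => by
      simp only [LinearMap.comp_apply, LinearMap.add_apply, LinearMap.sub_apply, LinearMap.id_apply, map_add, shear0Nil_shear0Nil]
      abel)

omit hp in
/-- `shear0 x = x + x_π·e_1`. [folklore] -/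
theorem shear0_apply (x : Fin 2 → ℚ) : shear0 x = x + x 1 • Pi.single (0 : Fin 2) (1 : ℚ) := rfl

omit hp in
/-- `shear0⁻¹ x = x − x_π·e_1`. [folklore] -/
theorem shear0_symm_apply (x : Fin 2 → ℚ) : shear0.symm x = x - x 1 • Pi.single (0 : Fin 2) (1 : ℚ) := rfl

/-- `shear0` is a lattice automorphism (an element of RAM's Ism). [folklore] -/
theorem shear0_mem_latticeAuts : shear0 ∈ latticeAuts p := fun x => by
  constructor
  · intro hx a
    rw [shear0_apply, Pi.add_apply, Pi.smul_apply, smul_eq_mul]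
    exact (hx a).add (IsPInt.mul' (hx 1) (intVec_single p 0 a))
  · intro hx a
    have h := hx a
    have h1 : IsPInt p (x 1) := by have := hx 1; simpa [shear0_apply] using this
    rw [shear0_apply, Pi.add_apply, Pi.smul_apply, smul_eq_mul] at h
    have h2 := h.add (IsPInt.mul' h1 (intVec_single p 0 a)).neg
    rwa [add_neg_cancel_right] at h2

omit hp in
/-- Matrix entries of the shear: `shear0(e_b)_a = [a = b] + [a = 1 ∧ b = π]`; in particular column `1` is `e_1` and `(1, π) ↦ 1`. [folklore] -/
theorem ent_shear0 (a b : Fin 2) : ent shear0 a b = (if a = b then 1 else 0) + (if b = 1 then (if a = 0 then 1 else 0) else 0) := by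
  unfold ent
  rw [shear0_apply, Pi.add_apply, Pi.smul_apply, Pi.single_apply, Pi.single_apply, Pi.single_apply, smul_eq_mul]
  by_cases hb : b = 1
  · subst hb; simp
  · have hb0 : b = 0 := by omega
    subst hb0; simp

omit hp in
/-- Matrix entries of the identity: `δ_{ab}`. [folklore] -/
theorem ent_refl (a b : Fin 2) : ent (LinearEquiv.refl ℚ (Fin 2 → ℚ)) a b = if a = b then 1 else 0 := by
  unfold ent; rw [LinearEquiv.refl_apply, Pi.single_apply]

/-- The per-factor family «`shear0` on the first tensor factor, identity on the others». [claim: Mochizuki2012, status: disputed] -/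
def gfam (j : toyIndex.Label) (vQ : toyIndex.VQ) : toyIndex.Caps j → toyIndex.Fibre vQ → ((Fin 2 → ℚ) ≃ₗ[ℚ] (Fin 2 → ℚ)) :=
  fun i _ => if (i : ℕ) = 0 then shear0 else LinearEquiv.refl ℚ _

/-- **The STABILISING FAMILY `stabFam`**: the (Ind2)-family acting by `shear0` on the first tensor factor of every packet.
[claim: Mochizuki2012, status: disputed] -/
def stabFam : (ramShells p).PacketAut := fun j vQ => (ramShells p).factorwise j vQ fun i => (ramShells p).summandwise vQ (gfam j vQ i)

/-- `stabFam` is an (Ind2)-family … [folklore] -/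
theorem stabFam_mem_Ind2Family : stabFam p ∈ (ramShells p).Ind2Family := fun j vQ =>
  ⟨gfam j vQ, fun i v => by
    unfold gfam; split_ifs
    · exact shear0_mem_latticeAuts p
    · exact refl_mem_latticeAuts p, rfl⟩

/-- … hence lies in `⟨(Ind1) ∪ (Ind2)⟩`. [folklore] -/
theorem stabFam_mem_closure : stabFam p ∈ indG p := Subgroup.subset_closure (Or.inr (stabFam_mem_Ind2Family p))

omit hp in
/-- **Matrix of `stabFam` in the tensor basis**: `stabFam(c·e_{ε'})_ε = c·Π_i (g_i)_{ε(i) ε'(i)}`. [folklore] -/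
theorem coord_stabFam_smul_tb (j : toyIndex.Label) (vQ : toyIndex.VQ) (c : ℚ) (ε ε' : toyIndex.Caps j → Fin 2) :
    coord p j vQ (stabFam p j vQ (c • tb p j vQ ε')) ε = c * ∏ i, ent (gfam j vQ i (fib vQ)) (ε i) (ε' i) := by
  unfold stabFam
  rw [map_smul, coord_smul, coord_factorwise_tb]

omit hp in
/-- `stabFam` FIXES every scaled basis monomial whose first factor is `1` (`ε'(0) = 1`, i.e. index `0`). [folklore] -/
theorem stabFam_smul_tb_of_first_zero (j : toyIndex.Label) (vQ : toyIndex.VQ) (c : ℚ) (ε' : toyIndex.Caps j → Fin 2) (h0 : ε' 0 = 0) :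
    stabFam p j vQ (c • tb p j vQ ε') = c • tb p j vQ ε' := by
  refine (tb p j vQ).ext_elem fun ε => ?_
  show coord p j vQ _ ε = coord p j vQ _ ε
  rw [coord_stabFam_smul_tb, coord_smul, coord_tb]
  congr 1
  have h : ∀ i, ent (gfam j vQ i (fib vQ)) (ε i) (ε' i) = if ε i = ε' i then 1 else 0 := by
    intro i
    by_cases hi : (i : ℕ) = 0
    · have hi0 : i = 0 := Fin.ext hi
      subst hi0
      unfold gfam
      rw [if_pos hi, ent_shear0, h0]
      simp
    · unfold gfam
      rw [if_neg hi, ent_refl]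
  simp_rw [h]
  rw [Finset.prod_boole]
  by_cases hε : ε' = ε
  · subst hε; simp
  · rw [if_neg hε, if_neg]
    intro hall
    exact hε (funext fun i => ((hall i (Finset.mem_univ i))).symm)

omit hp in
/-- At a nonzero label the index `(1,…,1,π)` has first factor `1`. [folklore] -/
theorem last1_zero {j : toyIndex.Label} (hj : j ≠ 0) : last1 j 0 = 0 := by
  unfold last1
  rw [if_neg]
  intro h
  have h1 := congrArg Fin.val h
  simp only [Fin.val_zero, Fin.val_last] at h1
  exact hj (Fin.ext (by simpa using h1.symm))

omit hp in
/-- **`stabFam` FIXES the honest Kummer element `π^k` at every nonzero label** (its tensor index has first factor `1`). [folklore] -/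
theorem stabFam_piElt {j : toyIndex.Label} (hj : j ≠ 0) (vQ : toyIndex.VQ) (k : ℤ) : stabFam p j vQ (piElt p j vQ k) = piElt p j vQ k := by
  unfold piElt
  refine stabFam_smul_tb_of_first_zero p j vQ _ _ ?_
  split_ifs
  · rfl
  · exact last1_zero hj

omit hp in
/-- **`stabFam` FIXES the Θ-pilot's Kummer tuple** (and every tuple of `π`-powers). [folklore] -/
theorem starAut_stabFam_thetaTuple (m : ℕ) (v : toyIndex.V) :
    (ramShells p).starAut (stabFam p) v (thetaTuple p m v) = thetaTuple p m v := by
  funext j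
  exact stabFam_piElt p j.2 (toyIndex.over v) _

variable (m : ℕ)

/-- **… but MOVES the Θ-box `box m` at label `1`** (every `m`): for `m = 2a+1` the point `p^a·e_{π1} ∈ box m` goes to `p^a·(e_{π1} + e_{11}) ∉ box m`,
for `m = 2a` the point `p^{a−1}·e_{ππ} ∈ box m` goes to `p^{a−1}·(e_{ππ} + e_{1π}) ∉ box m`. [folklore] -/
theorem stabFam_moves_thetaBox (vQ : toyIndex.VQ) : ∃ x ∈ box p 1 vQ (m : ℤ), stabFam p 1 vQ x ∉ box p 1 vQ (m : ℤ) := by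
  have hc : ((1 : toyIndex.Label) : ℕ) = 1 := rfl
  have h10 : (1 : toyIndex.Label) ≠ 0 := by decide
  -- the second tensor index at label `1` is the last one
  have hlast : ∀ i : toyIndex.Caps 1, (i : ℕ) ≠ 0 → i = Fin.last _ := fun i hi => by
    apply Fin.ext; have h1 := i.isLt; rw [Fin.val_last]; omega
  rcases Int.emod_two_eq_zero_or_one (m : ℤ) with h | h
  · refine ⟨(p : ℚ) ^ ((m : ℤ) / 2 - 1) • tb p 1 vQ (ones 1),
      (ppow_smul_tb_mem_box_iff _ _ _).2 (by rw [wt_ones, hc]; push_cast; omega), fun hmem => ?_⟩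
    have h1 := hmem (last1 1)
    rw [coord_stabFam_smul_tb, wt_last1] at h1
    have hprod : ∏ i, ent (gfam 1 vQ i (fib vQ)) (last1 1 i) (ones 1 i) = 1 := by
      refine Finset.prod_eq_one fun i _ => ?_
      by_cases hi : (i : ℕ) = 0
      · have hi0 : i = 0 := Fin.ext hi
        subst hi0
        simp [gfam, ent_shear0, last1_zero h10, ones]
      · have hg : gfam 1 vQ i (fib vQ) = LinearEquiv.refl ℚ _ := by unfold gfam; rw [if_neg hi]
        have hl1 : last1 (1 : toyIndex.Label) i = 1 := by unfold last1; rw [if_pos (hlast i hi)]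
        rw [hg, ent_refl, hl1]
        simp [ones]
    rw [hprod, mul_one, ple_ppow_iff] at h1
    push_cast at h1
    omega
  · refine ⟨(p : ℚ) ^ ((m : ℤ) / 2) • tb p 1 vQ (one0 1), (ppow_smul_tb_mem_box_iff _ _ _).2 (by rw [wt_one0]; push_cast; omega),
      fun hmem => ?_⟩
    have h1 := hmem (zeros 1)
    rw [coord_stabFam_smul_tb, wt_zeros] at h1
    have hprod : ∏ i, ent (gfam 1 vQ i (fib vQ)) (zeros 1 i) (one0 1 i) = 1 := by
      refine Finset.prod_eq_one fun i _ => ?_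
      by_cases hi : (i : ℕ) = 0
      · have hi0 : i = 0 := Fin.ext hi
        subst hi0
        simp [gfam, ent_shear0, zeros, one0]
      · have hi' : i ≠ 0 := fun h0 => hi (by rw [h0]; rfl)
        simp [gfam, hi, ent_refl, zeros, one0, hi']
    rw [hprod, mul_one, ple_ppow_iff] at h1
    push_cast at h1
    omega

/-! ## 2. The frozen Θ-pin is unsatisfiable on RAM -/

/-- **What (hρ) + (pΘ) force in general**: under `ThetaPinned`, every indeterminacy fixing the column's Kummer datum `frobΨ m'` FIXES the
Θ-region `thetaRegion m'` — the region is read off the datum equivariantly. [claim: Mochizuki2012, status: disputed] -/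
theorem thetaRegion_stable_of_thetaPinned {T : ThetaIndex} (S : LatticeSituation T) (P : Cor312.Setting S.toSituation)
    (ρ : (∀ v : T.V, v ∈ T.Vbad → Set (S.L.StarPacket v)) → ∀ (j : T.Label) (vQ : T.VQ), Set (S.L.Packet j vQ))
    (h : ThetaPinned S P ρ) {Φ : S.L.PacketAut} (hΦ : Φ ∈ Subgroup.closure (S.L.Ind1Family ∪ S.L.Ind2Family)) (m' : ℤ)
    (hfix : ∀ (v : T.V) (hv : v ∈ T.Vbad), S.L.starAut Φ v '' (S.col P.n).frobΨ m' v hv = (S.col P.n).frobΨ m' v hv)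
    (j : T.Label) (vQ : T.VQ) : Φ j vQ '' P.thetaRegion m' j vQ = P.thetaRegion m' j vQ := by
  have h1 := h.1 Φ hΦ ((S.col P.n).frobΨ m') j vQ
  have h2 : (fun v hv => S.L.starAut Φ v '' (S.col P.n).frobΨ m' v hv) = (S.col P.n).frobΨ m' := by
    funext v hv; exact hfix v hv
  rw [h2, ← h.2 m' j vQ] at h1
  exact h1.symm

/-- **THE FROZEN Θ-PIN IS UNSATISFIABLE ON RAM(p, m), EVERY `m`, FOR EVERY REGION READING `ρ`**: `stabFam` fixes the Θ-tuple but moves the Θ-box.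
[claim: Mochizuki2012, status: disputed] -/
theorem not_thetaPinned_ram
    (ρ : (∀ v : toyIndex.V, v ∈ toyIndex.Vbad → Set ((ramShells p).StarPacket v)) →
      ∀ (j : toyIndex.Label) (vQ : toyIndex.VQ), Set ((ramShells p).Packet j vQ)) :
    ¬ ThetaPinned (ramLattice p m) (ramSettingL p m) ρ := fun h => by
  have hstab := thetaRegion_stable_of_thetaPinned (ramLattice p m) (ramSettingL p m) ρ h (stabFam_mem_closure p) 0
    (fun v _ => by
      show (ramShells p).starAut (stabFam p) v '' {thetaTuple p m v} = {thetaTuple p m v}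
      rw [Set.image_singleton, starAut_stabFam_thetaTuple]) 1 ()
  have hreg : (ramSettingL p m).thetaRegion 0 1 () = box p 1 () (m : ℤ) := by
    have := ramSetting_thetaRegion p m 0 1 ()
    have hj : jsq (1 : toyIndex.Label) = 1 := rfl
    rw [hj, mul_one] at this
    exact this
  rw [hreg] at hstab
  obtain ⟨x, hx, hx'⟩ := stabFam_moves_thetaBox p m ()
  exact hx' (hstab ▸ Set.mem_image_of_mem _ hx)

/-- Hence `¬ PinnedRegions` on RAM for every `ρ`, `qK` … [claim: Mochizuki2012, status: disputed] -/
theorem not_pinnedRegions_ram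
    (ρ : (∀ v : toyIndex.V, v ∈ toyIndex.Vbad → Set ((ramShells p).StarPacket v)) →
      ∀ (j : toyIndex.Label) (vQ : toyIndex.VQ), Set ((ramShells p).Packet j vQ))
    (qK : ∀ v : toyIndex.V, v ∈ toyIndex.Vbad → Set ((ramShells p).StarPacket v)) :
    ¬ PinnedRegions (ramLattice p m) (ramSettingL p m) ρ qK := fun h => not_thetaPinned_ram p m ρ h.1

/-- … and the pinned schema `GapA″` holds VACUOUSLY on RAM (the bed does not engage pinned-schema rows; its cells are at Statement /
Licence / datum level). [claim: Mochizuki2012, status: disputed] -/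
theorem gapA''_ram_vacuous
    (ρ : (∀ v : toyIndex.V, v ∈ toyIndex.Vbad → Set ((ramShells p).StarPacket v)) →
      ∀ (j : toyIndex.Label) (vQ : toyIndex.VQ), Set ((ramShells p).Packet j vQ))
    (qK : ∀ v : toyIndex.V, v ∈ toyIndex.Vbad → Set ((ramShells p).StarPacket v)) :
    GapA'' (ramLattice p m) (ramSettingL p m) ρ qK := fun h => absurd h (not_pinnedRegions_ram p m ρ qK)

end Summit.ABC.IUTFork.Repair.CandMochizuki7Ram

end
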